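import Mathlib
import Summits.ValiantsHypothesis.ValiantsHypothesis.Theorems.KPlusLogSqLawSymmetricDesigns

/-!
# Patchworking INTO the tridiagonal sector: banded symmetric designs bound the sector's census rows from below

HONEST FRAMING.  Helper for the desk's «sector-B on the tridiagonal (symmetric Hessenberg) sector» docket (lead R1423 (2)(α); registered
stubs `stub_tridiagonalSectorB` / `stub_tridiagonalSectorBDiag` on `WeakLifting` = stmt-ValiantsHypothesis-19561, route `KPlusLogSqLaw`,
cell `pub-symmetroid`; seat val-sym-lift-p2 g3, 2026-08-26).  A BRIDGE only: it turns any certified chain of a SYMMETRIC BANDED tropical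
design (valuations and signs symmetric in the entry indices, signs ZERO outside the band `|i − j| ≤ 1`) into a real SYMMETRIC TRIDIAGONAL
lacunary pencil of the same format with at least as many distinct positive determinant zeros as the chain has sign alternations
(Viro patchworking, the tree's `TropicalCensus.le_card_posRoots_patchMatrix` + `patchMatrix_isSymm`; the only new remark is that the
patchworked matrices inherit the band: `patchMatrix_eq_zero_of_eps`).  Consequently every sector row «all symmetric tridiagonal
`(m,K)` pencils have `≤ B` distinct positive (resp. real) det-zeros» bounds the alternation count of every such design
(`bandedDesign_le_of_tridiagonalPosRootRow`, `bandedDesign_le_of_tridiagonalRealRootRow`; the tridiagonality predicate is spelled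
exactly as in the registered stub).  This is how exact tropical searches on the sector (e.g. symmetric tridiagonal `(3,5)` designs with
`≥ 30` alternating vertices against conjb-2's additive heuristic `(3m−2)(K−1) = 28`) become kernel rows; the first instance is
`…KPlusLogSqLawTridiagonalThreeThree` (`(3,3)`: the sector attains the Descartes ceiling `9`).  Nothing here asserts anything about the
sector law in the window, `WeakLifting`, `TropicalB`, `MatrixDescartes` (stmt-ValiantsHypothesis-18050), the DoorA registers or VP ≠ VNP.
[folklore] Viro patchworking bookkeeping.
-/

set_option linter.dupNamespace false
set_option autoImplicit false

namespace Summit.ValiantsHypothesis.ValiantsHypothesis.Theorems.KPlusLogSqLaw.TridiagonalSector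

open Summit.ValiantsHypothesis.ValiantsHypothesis.Theorems.MatrixDescartes.Negative
open Summit.ValiantsHypothesis.ValiantsHypothesis.Theorems.LacunarySymmetroidMatrixDescartes.TropicalCensus
open Polynomial Finset

variable {m K : ℕ}

/-- an absent incidence patchworks to a zero entry: `ε i j l = 0 → patchMatrix b v ε l i j = 0`. [folklore] -/
theorem patchMatrix_eq_zero_of_eps (b : ℝ) (v ε : Fin m → Fin m → Fin K → ℤ) {l : Fin K} {i j : Fin m}
    (h : ε i j l = 0) : patchMatrix b v ε l i j = 0 := by
  simp only [patchMatrix, h, Int.cast_zero, zero_mul]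

/-- a design whose signs vanish outside the band `|i − j| ≤ 1` patchworks to TRIDIAGONAL coefficient matrices. [folklore] -/
theorem patchMatrix_tridiagonal (b : ℝ) (v ε : Fin m → Fin m → Fin K → ℤ)
    (hband : ∀ l (i j : Fin m), (i : ℕ) + 1 < j ∨ (j : ℕ) + 1 < i → ε i j l = 0)
    (l : Fin K) (i j : Fin m) (hij : (i : ℕ) + 1 < j ∨ (j : ℕ) + 1 < i) : patchMatrix b v ε l i j = 0 :=
  patchMatrix_eq_zero_of_eps b v ε (hband l i j hij)

/-- **Banded symmetric designs patchwork INTO the tridiagonal sector.**  A symmetric banded design of format `(m, K)` with a chain of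
`n + 1` uniquely dominant terms of alternating signs at strictly increasing integer slopes yields a real SYMMETRIC TRIDIAGONAL `K`-term
`m × m` lacunary pencil (same exponents) with at least `n` distinct positive determinant zeros. [folklore] -/
theorem exists_symm_tridiagonal_pencil_of_chain (d : Fin K → ℕ) (v ε : Fin m → Fin m → Fin K → ℤ)
    (hv : ∀ i j l, v i j l = v j i l) (hεs : ∀ i j l, ε i j l = ε j i l) (hε : ∀ i j l, (ε i j l).natAbs ≤ 1)
    (hband : ∀ l (i j : Fin m), (i : ℕ) + 1 < j ∨ (j : ℕ) + 1 < i → ε i j l = 0)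
    {n : ℕ} (θ : Fin (n + 1) → ℤ) (hθ : StrictMono θ) (p : Fin (n + 1) → Equiv.Perm (Fin m) × (Fin m → Fin K))
    (hdom : ∀ k, IsDominant d v ε (θ k) (p k))
    (halt : ∀ k : Fin n, termSign ε (p k.castSucc) * termSign ε (p k.succ) < 0) :
    ∃ S : Fin K → Matrix (Fin m) (Fin m) ℝ, (∀ l, (S l).IsSymm) ∧
      (∀ l (i j : Fin m), (i : ℕ) + 1 < j ∨ (j : ℕ) + 1 < i → S l i j = 0) ∧
      n ≤ ((∑ l, (X : ℝ[X]) ^ d l • (S l).map C).det.roots.toFinset.filter (fun t => 0 < t)).card :=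
  ⟨patchMatrix ((Fintype.card (Equiv.Perm (Fin m) × (Fin m → Fin K)) : ℝ) + 1) v ε,
    patchMatrix_isSymm _ v ε hv hεs, patchMatrix_tridiagonal _ v ε hband,
    le_card_posRoots_patchMatrix d v ε hε θ hθ p hdom halt⟩

/-- **Sector rows bound banded symmetric designs (positive-zero currency).**  If every symmetric tridiagonal `K`-term `m × m` pencil
has at most `B` distinct positive determinant zeros, then every chain of a symmetric banded design of format `(m, K)` has at most `B`
sign alternations. [folklore] -/
theorem bandedDesign_le_of_tridiagonalPosRootRow {B : ℕ}
    (hrow : ∀ (d : Fin K → ℕ) (S : Fin K → Matrix (Fin m) (Fin m) ℝ), (∀ l, (S l).IsSymm) →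
      (∀ l (i j : Fin m), (i : ℕ) + 1 < j ∨ (j : ℕ) + 1 < i → S l i j = 0) →
      ((∑ l, (X : ℝ[X]) ^ d l • (S l).map C).det.roots.toFinset.filter (fun t => 0 < t)).card ≤ B)
    (d : Fin K → ℕ) (v ε : Fin m → Fin m → Fin K → ℤ)
    (hv : ∀ i j l, v i j l = v j i l) (hεs : ∀ i j l, ε i j l = ε j i l) (hε : ∀ i j l, (ε i j l).natAbs ≤ 1)
    (hband : ∀ l (i j : Fin m), (i : ℕ) + 1 < j ∨ (j : ℕ) + 1 < i → ε i j l = 0)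
    {n : ℕ} (θ : Fin (n + 1) → ℤ) (hθ : StrictMono θ) (p : Fin (n + 1) → Equiv.Perm (Fin m) × (Fin m → Fin K))
    (hdom : ∀ k, IsDominant d v ε (θ k) (p k))
    (halt : ∀ k : Fin n, termSign ε (p k.castSucc) * termSign ε (p k.succ) < 0) : n ≤ B := by
  obtain ⟨S, hS, hT, hn⟩ := exists_symm_tridiagonal_pencil_of_chain d v ε hv hεs hε hband θ hθ p hdom halt
  exact hn.trans (hrow d S hS hT)

/-- **Sector rows bound banded symmetric designs (all-real-zeros currency, the registered stub's functional).**  If every symmetric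
tridiagonal `K`-term `m × m` pencil has at most `B` distinct REAL determinant zeros, then every chain of a symmetric banded design of
format `(m, K)` has at most `B` sign alternations (positive zeros are real zeros). [folklore] -/
theorem bandedDesign_le_of_tridiagonalRealRootRow {B : ℕ}
    (hrow : ∀ (d : Fin K → ℕ) (S : Fin K → Matrix (Fin m) (Fin m) ℝ), (∀ l, (S l).IsSymm) →
      (∀ l (i j : Fin m), (i : ℕ) + 1 < j ∨ (j : ℕ) + 1 < i → S l i j = 0) →
      (Matrix.det (∑ l, ((Polynomial.X : Polynomial ℝ) ^ d l) • (S l).map Polynomial.C)).roots.toFinset.card ≤ B)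
    (d : Fin K → ℕ) (v ε : Fin m → Fin m → Fin K → ℤ)
    (hv : ∀ i j l, v i j l = v j i l) (hεs : ∀ i j l, ε i j l = ε j i l) (hε : ∀ i j l, (ε i j l).natAbs ≤ 1)
    (hband : ∀ l (i j : Fin m), (i : ℕ) + 1 < j ∨ (j : ℕ) + 1 < i → ε i j l = 0)
    {n : ℕ} (θ : Fin (n + 1) → ℤ) (hθ : StrictMono θ) (p : Fin (n + 1) → Equiv.Perm (Fin m) × (Fin m → Fin K))
    (hdom : ∀ k, IsDominant d v ε (θ k) (p k))
    (halt : ∀ k : Fin n, termSign ε (p k.castSucc) * termSign ε (p k.succ) < 0) : n ≤ B := by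
  obtain ⟨S, hS, hT, hn⟩ := exists_symm_tridiagonal_pencil_of_chain d v ε hv hεs hε hband θ hθ p hdom halt
  exact hn.trans ((Finset.card_filter_le _ _).trans (hrow d S hS hT))

end Summit.ValiantsHypothesis.ValiantsHypothesis.Theorems.KPlusLogSqLaw.TridiagonalSector
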